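import Literature.AnabelianGeometry.EtaleTheta.ThetaCoversAbelianWitness
import Literature.AnabelianGeometry.EtaleTheta.Discharge.Sec2AutKNormalizersC
import HarnessLib

/-!
# [EtTh] Prop. 2.2 (ii), last sentence — NEGATIVE SIDE: the coset characterisation of the image of `ι̲`
# is NOT a consequence of the Prop. 2.2 (i) data over `CoverDataAx` (it fails at the abelian-`Δ̄_X` witness)

Mochizuki, *The étale theta function …* [EtTh], Publ. RIMS **45** (2009), §2, Prop. 2.2 (ii), PRIMS PDF p. 37,
last sentence: «the image of `ι̲` in `Δ̄_C/Δ̄_{X̲}` may be characterized as the unique coset of `Δ̄_C/Δ̄_{X̲}` that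
lifts the nontrivial element of `Gal(X/C) = Δ̄_C/Δ̄_X` and normalizes the subgroup `Δ̄_{X̲̲} ⊆ Δ̄_C`»
[cite: MochizukiEtTh2009, Prop 2.2(ii) p.37].

Cell abc-iut, layer L2, seat abc-iut-w6-d082 (gen 3; node EtTh:Prop2.2(ii)). Companion of
`Discharge/Sec2Prop22iiInversionCoset.lean` (p454441), which PROVES the sentence over abc-iut-L2-t2's
`CoverDataAx` under the printed definition of `Δ̄_Θ` (`hΘ : ⁅Δ_X, Δ_X⁆·Ker = Δ̄_Θ`-preimage, GAP-LEDGER G-L2d3-1)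
as `N_{Π_C}(Im(s_ι)) = Π_{C̲}`, and at the arithmetic model with `hΘ` discharged. HERE: the input `hΘ` is
NECESSARY in substance — PURE FINITE GROUP THEORY over abc-iut-w6-d041's abelian witness
`AbelianWitness.abelianWitness l hl : CoverDataAx l` (`Π_C = ((ℤ/l)² ⋊ C₂) × ℤ/l`, `Π_X = (ℤ/l)³` abelian,
`Ker = 1`, `Δ̄_Θ = 1 × ℤ/l`, `G_K = 1`), for every odd `l ≠ 1`:

* explicit Def. 2.1 / Prop. 2.2 (i) data there: `Π_{C̲} := {first (ℤ/l)-coordinate = 0}` (`Hpm`, type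
  `(1, l-tors)±`: `isTypeLTorsPm_Hpm`), the inversion `ι̲ := ((1, gen), 1)` (`isInversion_iota`), and the
  `(−1)`-eigenspace datum `E := Π_{C̲} ∩ Π_X ∩ Ker(pr_{ℤ/l})` (`isMinusEigen_E`) — so the hypotheses of the
  positive theorems are INHABITED at the witness (no vacuity);
* `not_normalizer_E_le` — `N_{Π_C}(E) ⊄ Π_{C̲}`: `Π_X` is abelian, so the element `a := ((δ₁, 1), 1)`,
  `δ₁ = (1, 0)`, of `Π_X ∖ Π_{X̲}` normalises `E`;
* `exists_two_normalising_lifts` — hence the lifts `ι̲` and `ι̲·a` of the nontrivial element of `Gal(X/C)` BOTH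
  normalise `Δ̄_{X̲̲} = E` while `ι̲⁻¹·(ι̲·a) = a ∉ Δ̄_{X̲}`: TWO distinct cosets of `Δ̄_{X̲}` normalise `Δ̄_{X̲̲}` —
  the printed uniqueness FAILS at the witness;
* **`not_forall_normalizer_eigen_le`**, **`not_forall_inversion_coset_unique`** (+ the `l = 3` instances):
  the universal closures over `CoverDataAx l` of p454441's `normalizer_eigen_le` / `mem_normalizer_eigen_iff_of_lift`
  WITHOUT `hΘ` are FALSE.

CONSISTENCY/INDEPENDENCE WITNESS ONLY (no claim about print: in print `Δ̄_X` is the Heisenberg group and `hΘ`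
holds — abc-iut-L2-t11's `coverDataAx_hTheta`). The `def`s below (a coordinate function, two subgroups, two
elements, one homomorphism of the TOY group) are local toy bookkeeping of this negative file, exactly like
abc-iut-w6-d041's; no named `Prop` fact; nothing of another seat is edited; no side taken on [IUTchIII] Cor. 3.12.
-/

namespace Literature.AnabelianGeometry.EtaleTheta

namespace ThetaCovers

namespace AbelianWitness

open Multiplicative

variable (l : ℕ)

/-! ## 1. The first `(ℤ/l)`-coordinate on `Π_C = ((ℤ/l)² ⋊ C₂) × ℤ/l` -/

/-- The first `ℤ/l`-coordinate of the `(ℤ/l)²`-part of an element of the toy `Π_C` (plays the quotient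
`Π̄^ell_X ↠ Q` of Def. 2.1, extended to `Π_C` up to sign). (toy bookkeeping; no claim about print)
[cite: MochizukiEtTh2009, Def 2.1 p.36] -/
def fc (x : PiC l) : ZMod l := (toAdd x.1.left).1

/-- `fc 1 = 0`. (toy bookkeeping) [cite: MochizukiEtTh2009, Def 2.1 p.36] -/
@[simp] theorem fc_one : fc l 1 = 0 := by
  simp [fc]

/-- On `Π_X` (trivial `C₂`-component) the coordinate is additive. (toy bookkeeping) [cite: MochizukiEtTh2009, Def 2.1 p.36] -/
theorem fc_mul_of_mem {x : PiC l} (hx : x ∈ PiX l) (y : PiC l) : fc l (x * y) = fc l x + fc l y := by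
  rw [mem_PiX] at hx
  simp [fc, SemidirectProduct.mul_left, hx]

/-- Off `Π_X` (component `gen`, acting by inversion) the coordinate of a product is a difference. (toy bookkeeping)
[cite: MochizukiEtTh2009, Rmk 2.1.1 p.36] -/
theorem fc_mul_of_not_mem {x : PiC l} (hx : x ∉ PiX l) (y : PiC l) : fc l (x * y) = fc l x - fc l y := by
  have hr : x.1.right = gen := by
    rcases eq_one_or_eq_gen x.1.right with h | h
    · exact absurd ((mem_PiX l).mpr h) hx
    · exact h
  simp [fc, SemidirectProduct.mul_left, hr, negPow_gen_apply, sub_eq_add_neg]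

/-- The coordinate of an inverse vanishes iff the coordinate does. (toy bookkeeping) [cite: MochizukiEtTh2009, Def 2.1 p.36] -/
theorem fc_inv_eq_zero_iff (x : PiC l) : fc l x⁻¹ = 0 ↔ fc l x = 0 := by
  rcases eq_one_or_eq_gen x.1.right with h | h
  · have : fc l x⁻¹ = -fc l x := by
      simp [fc, SemidirectProduct.inv_left, h]
    rw [this, neg_eq_zero]
  · have hg : (gen : C2)⁻¹ = gen := by decide
    have : fc l x⁻¹ = fc l x := by
      simp [fc, SemidirectProduct.inv_left, h, hg, negPow_gen_apply]
    rw [this]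

/-! ## 2. The data `Π_{C̲}`, `ι̲`, `E` at the witness -/

/-- **`Π_{C̲}` of the toy**: the elements of `Π_C` with first `ℤ/l`-coordinate `0` (index `l`; meets `Π_X` in
`Π_{X̲} = {first coordinate 0} ∩ Π_X`, of index `2` in it). (toy bookkeeping; no claim about print)
[cite: MochizukiEtTh2009, Def 2.1 p.36] -/
def Hpm : Subgroup (PiC l) where
  carrier := {x | fc l x = 0}
  mul_mem' := by
    intro x y hx hy
    simp only [Set.mem_setOf_eq] at hx hy ⊢
    by_cases h : x ∈ PiX l
    · rw [fc_mul_of_mem l h, hx, hy, add_zero]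
    · rw [fc_mul_of_not_mem l h, hx, hy, sub_zero]
  one_mem' := by simp
  inv_mem' := by
    intro x hx
    simp only [Set.mem_setOf_eq] at hx ⊢
    exact (fc_inv_eq_zero_iff l x).mpr hx

/-- Membership in `Π_{C̲}`. (toy bookkeeping) [cite: MochizukiEtTh2009, Def 2.1 p.36] -/
theorem mem_Hpm {x : PiC l} : x ∈ Hpm l ↔ fc l x = 0 := Iff.rfl

/-- **The inversion `ι̲` of the toy**: `((1, gen), 1)`. (toy bookkeeping; no claim about print)
[cite: MochizukiEtTh2009, Prop 2.2 p.36] -/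
def iota : PiC l := (SemidirectProduct.inr gen, 1)

/-- `ι̲ ∉ Π_X`. (toy bookkeeping) [cite: MochizukiEtTh2009, Prop 2.2 p.36] -/
theorem iota_not_mem_PiX : iota l ∉ PiX l := by
  rw [mem_PiX, iota, SemidirectProduct.right_inr]
  decide

/-- `ι̲ ∈ Π_{C̲}`. (toy bookkeeping) [cite: MochizukiEtTh2009, Prop 2.2 p.36] -/
theorem iota_mem_Hpm : iota l ∈ Hpm l := by
  simp [mem_Hpm, fc, iota]

/-- **The `(−1)`-eigenspace datum `E` of the toy**: `Π_{C̲} ∩ Π_X ∩ Ker(pr_{ℤ/l})` = `{(0, y)} × 1 × 1`.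
(toy bookkeeping; no claim about print) [cite: MochizukiEtTh2009, Prop 2.2(i) p.37] -/
def E : Subgroup (PiC l) := (Hpm l ⊓ PiX l) ⊓ (MonoidHom.snd (SD l) (Zl l)).ker

/-- Membership in `E`. (toy bookkeeping) [cite: MochizukiEtTh2009, Prop 2.2(i) p.37] -/
theorem mem_E {x : PiC l} : x ∈ E l ↔ (fc l x = 0 ∧ x ∈ PiX l) ∧ x.2 = 1 := by
  simp only [E, Subgroup.mem_inf, mem_Hpm, MonoidHom.mem_ker, MonoidHom.coe_snd]

/-- `E ⊆ Π_X`. (toy bookkeeping) [cite: MochizukiEtTh2009, Prop 2.2(i) p.37] -/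
theorem E_le_PiX : E l ≤ PiX l := fun _ hx => ((mem_E l).mp hx).1.2

/-- **The element `a := ((δ₁, 1), 1)`, `δ₁ = (1, 0)`** of `Π_X` — outside `Π_{X̲}` as soon as `l ≠ 1`.
(toy bookkeeping; no claim about print) [cite: MochizukiEtTh2009, Def 2.1 p.36] -/
def aElt : PiC l := (SemidirectProduct.inl (ofAdd ((1 : ZMod l), (0 : ZMod l))), 1)

/-- `a ∈ Π_X`. (toy bookkeeping) [cite: MochizukiEtTh2009, Def 2.1 p.36] -/
theorem aElt_mem_PiX : aElt l ∈ PiX l := by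
  rw [mem_PiX, aElt, SemidirectProduct.right_inl]

/-- `fc a = 1`. (toy bookkeeping) [cite: MochizukiEtTh2009, Def 2.1 p.36] -/
theorem fc_aElt : fc l (aElt l) = 1 := by
  simp [fc, aElt]

/-- `a ∉ Π_{C̲}` for `l ≠ 1` (`1 ≠ 0` in `ℤ/l`). (toy bookkeeping) [cite: MochizukiEtTh2009, Def 2.1 p.36] -/
theorem aElt_not_mem_Hpm (hl1 : l ≠ 1) : aElt l ∉ Hpm l := by
  haveI : Nontrivial (ZMod l) := ZMod.nontrivial_iff.mpr hl1
  rw [mem_Hpm, fc_aElt]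
  exact one_ne_zero

/-- In the abelian `Π_X`, every element of `Π_X` normalises every subgroup of `Π_X` — in particular `E`.
(toy bookkeeping) [cite: MochizukiEtTh2009, Prop 2.2(ii) p.37] -/
theorem mem_normalizer_E_of_mem_PiX {g : PiC l} (hg : g ∈ PiX l) :
    g ∈ Subgroup.normalizer ((E l : Subgroup (PiC l)) : Set (PiC l)) := by
  haveI hN : (PiX l).Normal := MonoidHom.normal_ker _
  rw [Subgroup.mem_normalizer_iff]
  intro h
  constructor
  · intro hh
    rwa [PiX_comm l hg (E_le_PiX l hh), mul_inv_cancel_right]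
  · intro hh
    have hhX : h ∈ PiX l := by
      have h1 : g * h * g⁻¹ ∈ PiX l := E_le_PiX l hh
      have h2 := hN.conj_mem _ h1 g⁻¹
      have e2 : g⁻¹ * (g * h * g⁻¹) * g⁻¹⁻¹ = h := by group
      rwa [e2] at h2
    rwa [PiX_comm l hg hhX, mul_inv_cancel_right] at hh

/-! ## 3. The Def. 2.1 / Prop. 2.2 (i) predicates HOLD for these data at the witness -/

section Witness

variable (hl : Odd l)

/-- The quotient `Π_X ↠ ℤ/l` by the first coordinate (its kernel is `Π_{X̲}`). (toy bookkeeping; no claim about print)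
[cite: MochizukiEtTh2009, Def 2.1 p.36] -/
def psi : ↥(abelianWitness l hl).PiX →* Multiplicative (ZMod l) where
  toFun x := ofAdd (fc l (x : PiC l))
  map_one' := by simp
  map_mul' x y := by
    have hx : ((x : PiC l)) ∈ PiX l := x.2
    rw [← ofAdd_add, ← fc_mul_of_mem l hx]
    rfl

/-- `Π_{X̲} := Π_{C̲} ∩ Π_X` is of type `(1, l-tors)` at the witness (`D_x = Δ̄_Θ ⊆ Π_{X̲}`, `Δ_X = Π_X`).
(witness bookkeeping; no claim about print) [cite: MochizukiEtTh2009, Def 2.1 p.36] -/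
theorem isTypeLTors_Hpm_inf : (abelianWitness l hl).toCoverData.IsTypeLTors (Hpm l ⊓ (abelianWitness l hl).PiX) := by
  have hΘ : ∀ x : PiC l, x ∈ barTheta l → x ∈ Hpm l ⊓ PiX l := fun x hx =>
    Subgroup.mem_inf.mpr ⟨by rw [mem_Hpm, fc, (mem_barTheta l).mp hx]; simp, barTheta_le_PiX l hx⟩
  refine
    { le := inf_le_right
      quot := ⟨psi l hl, ?_, ?_⟩
      barTheta_le := hΘ
      delta_sup := ?_
      Dx_le := hΘ }
  · intro q
    refine ⟨⟨(SemidirectProduct.inl (ofAdd (toAdd q, (0 : ZMod l))), 1), ?_⟩, ?_⟩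
    · change _ ∈ PiX l
      rw [mem_PiX, SemidirectProduct.right_inl]
    · change ofAdd (fc l _) = q
      simp [fc]
  · intro g
    change ofAdd (fc l (g : PiC l)) = 1 ↔ (g : PiC l) ∈ Hpm l ⊓ PiX l
    rw [Subgroup.mem_inf, mem_Hpm, ← ofAdd_zero, ofAdd.apply_eq_iff_eq]
    exact ⟨fun h => ⟨h, g.2⟩, fun h => h.1⟩
  · change (Hpm l ⊓ PiX l) ⊔ (PiX l ⊓ (1 : PiC l →* PUnit.{1}).ker) = PiX l
    rw [MonoidHom.ker_one, inf_top_eq]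
    exact sup_eq_right.mpr inf_le_right

/-- **`Π_{C̲}` is of type `(1, l-tors)±` at the witness** (`[Π_{C̲} : Π_{X̲}] = 2`). (witness bookkeeping; no claim
about print) [cite: MochizukiEtTh2009, Def 2.1 p.36] -/
theorem isTypeLTorsPm_Hpm : (abelianWitness l hl).toCoverData.IsTypeLTorsPm (Hpm l) := by
  refine ⟨isTypeLTors_Hpm_inf l hl, ?_⟩
  change (Hpm l ⊓ PiX l).relIndex (Hpm l) = 2
  haveI : (PiX l).Normal := MonoidHom.normal_ker _
  rw [Subgroup.inf_relIndex_left]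
  have hdvd : (PiX l).relIndex (Hpm l) ∣ 2 := by
    have h := Subgroup.relIndex_dvd_index_of_normal (PiX l) (Hpm l)
    rwa [index_PiX l] at h
  have hne : (PiX l).relIndex (Hpm l) ≠ 1 := by
    rw [Ne, Subgroup.relIndex_eq_one]
    exact fun h => iota_not_mem_PiX l (h (iota_mem_Hpm l))
  rcases (Nat.dvd_prime Nat.prime_two).mp hdvd with h | h
  · exact absurd h hne
  · exact h

/-- **`ι̲` is an inversion for `Π_{C̲}` at the witness** (`ι̲ ∈ Π_{C̲} ∩ Δ_C`, `ι̲ ∉ Π_X`; `Δ_C = Π_C` as `G_K = 1`).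
(witness bookkeeping; no claim about print) [cite: MochizukiEtTh2009, Prop 2.2 p.36] -/
theorem isInversion_iota : (abelianWitness l hl).toCoverData.IsInversion (Hpm l) (iota l) := by
  refine ⟨iota_mem_Hpm l, ?_, iota_not_mem_PiX l⟩
  change iota l ∈ (1 : PiC l →* PUnit.{1}).ker
  rw [MonoidHom.ker_one]; exact Subgroup.mem_top _

/-- **`E` is a `(−1)`-eigenspace datum (`IsMinusEigen`) for `(Π_{X̲}, Π_{C̲}, ι̲)` at the witness**: `Ker = 1 ⊆ E ⊆ Δ_{X̲}`,
normalised by the abelian `Π_X` and by `ι̲` (which inverts it), `E ∩ Δ̄_Θ = 1`, `E·Δ̄_Θ = Δ_{X̲}`, `ι̲` acts by `−1` on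
`E` and by `+1` on the central `Δ̄_Θ`. (witness bookkeeping; no claim about print) [cite: MochizukiEtTh2009, Prop 2.2(i) p.37] -/
theorem isMinusEigen_E :
    (abelianWitness l hl).toCoverData.IsMinusEigen (Hpm l ⊓ (abelianWitness l hl).PiX) (Hpm l) (iota l) (E l) := by
  have hXPiX : (abelianWitness l hl).PiX = PiX l := rfl
  have hker : (abelianWitness l hl).barKer = ⊥ := rfl
  have hΘ : (abelianWitness l hl).barTheta = barTheta l := rfl
  have hC : (abelianWitness l hl).toCoverData.DeltaC = ⊤ := by
    change (1 : PiC l →* PUnit.{1}).ker = ⊤; exact MonoidHom.ker_one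
  -- `ι̲ e ι̲⁻¹ e = 1` for `e ∈ E`
  have hminus : ∀ e ∈ E l, iota l * e * (iota l)⁻¹ * e = 1 := by
    intro e he
    obtain ⟨⟨-, heX⟩, he2⟩ := (mem_E l).mp he
    have h1 : iota l * e * (iota l)⁻¹ * e ∈ barTheta l := inv_ell_law l (iota_not_mem_PiX l) heX
    have h2 : (iota l * e * (iota l)⁻¹ * e).2 = 1 := by
      simp only [Prod.snd_mul, Prod.snd_inv, he2, iota, mul_one, inv_one]
    rw [mem_barTheta] at h1
    exact Prod.ext h1 h2
  refine
    { barKer_le := by rw [hker]; exact bot_le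
      le := by rw [hC, inf_top_eq]; exact inf_le_left
      conj_mem := ?_
      inf_eq := ?_
      sup_eq := ?_
      minus := fun e he => by rw [hker, Subgroup.mem_bot]; exact hminus e he
      plus := fun t ht => by
        rw [hker, Subgroup.mem_bot]
        rw [hΘ] at ht
        rw [barTheta_comm l ht (iota l), mul_inv_cancel_right, mul_inv_cancel]
      iota_conj := fun e he => by
        have h := hminus e he
        have e1 : iota l * e * (iota l)⁻¹ = e⁻¹ := mul_eq_one_iff_eq_inv.mp h
        rw [e1]; exact (E l).inv_mem he }
  · -- `Π_{X̲} ⊆ Π_X` is abelian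
    intro g hg e he
    rw [hXPiX] at hg
    rwa [PiX_comm l hg.2 (E_le_PiX l he), mul_inv_cancel_right]
  · rw [hΘ, hker, eq_bot_iff]
    intro x hx
    rw [Subgroup.mem_bot]
    obtain ⟨hxE, hxT⟩ := hx
    exact Prod.ext ((mem_barTheta l).mp hxT) ((mem_E l).mp hxE).2
  · rw [hΘ, hC, inf_top_eq, hXPiX]
    refine le_antisymm (sup_le inf_le_left fun x hx => ?_) fun x hx => ?_
    · exact Subgroup.mem_inf.mpr ⟨by rw [mem_Hpm, fc, (mem_barTheta l).mp hx]; simp, barTheta_le_PiX l hx⟩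
    · -- `x = (x.1, 1) · (1, x.2)` with `(x.1, 1) ∈ E`, `(1, x.2) ∈ Δ̄_Θ`
      obtain ⟨hxH, hxX⟩ := Subgroup.mem_inf.mp hx
      have e1 : x = ((x.1, 1) : PiC l) * ((1, x.2) : PiC l) := by ext <;> simp
      rw [e1]
      refine Subgroup.mul_mem _ (Subgroup.mem_sup_left ?_) (Subgroup.mem_sup_right ?_)
      · rw [mem_E]
        refine ⟨⟨?_, ?_⟩, rfl⟩
        · rw [mem_Hpm] at hxH; simpa [fc] using hxH
        · rw [mem_PiX] at hxX ⊢; exact hxX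
      · exact (mem_barTheta l).mpr rfl

/-! ## 4. The printed uniqueness FAILS at the witness -/

/-- **`N_{Π_C}(E) ⊄ Π_{C̲}` at the witness** (`l ≠ 1`): `a = ((δ₁, 1), 1) ∈ Π_X ∖ Π_{C̲}` normalises `E` because `Π_X` is
abelian. (independence witness; no claim about print) [cite: MochizukiEtTh2009, Prop 2.2(ii) p.37] -/
theorem not_normalizer_E_le (hl1 : l ≠ 1) :
    ¬ Subgroup.normalizer ((E l : Subgroup (abelianWitness l hl).PiC) : Set (abelianWitness l hl).PiC) ≤ Hpm l :=
  fun h => aElt_not_mem_Hpm l hl1 (h (mem_normalizer_E_of_mem_PiX l (aElt_mem_PiX l)))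

/-- **Two distinct cosets of `Δ̄_{X̲}` over the nontrivial element of `Gal(X/C)` normalise `Δ̄_{X̲̲}`** at the witness
(`l ≠ 1`): both `ι̲` and `g := ι̲·a` lie in `Δ_C ∖ Δ_X` and normalise `E`, while `ι̲⁻¹·g = a ∉ Δ_{X̲}`.
(independence witness; no claim about print) [cite: MochizukiEtTh2009, Prop 2.2(ii) p.37] -/
theorem exists_two_normalising_lifts (hl1 : l ≠ 1) :
    ∃ g : (abelianWitness l hl).PiC, g ∈ (abelianWitness l hl).toCoverData.DeltaC ∧ g ∉ (abelianWitness l hl).PiX ∧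
      g ∈ Subgroup.normalizer ((E l : Subgroup (abelianWitness l hl).PiC) : Set (abelianWitness l hl).PiC) ∧
      (iota l)⁻¹ * g ∉ (Hpm l ⊓ (abelianWitness l hl).PiX) ⊓ (abelianWitness l hl).toCoverData.DeltaC := by
  refine ⟨iota l * aElt l, ?_, ?_, ?_, ?_⟩
  · change _ ∈ (1 : PiC l →* PUnit.{1}).ker
    rw [MonoidHom.ker_one]; exact Subgroup.mem_top _
  · change iota l * aElt l ∉ PiX l
    intro h
    exact iota_not_mem_PiX l (((PiX l).mul_mem_cancel_right (aElt_mem_PiX l)).mp h)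
  · exact Subgroup.mul_mem _ ((abelianWitness l hl).le_normalizer_eigen (isInversion_iota l hl)
      (isMinusEigen_E l hl) (iota_mem_Hpm l)) (mem_normalizer_E_of_mem_PiX l (aElt_mem_PiX l))
  · rw [inv_mul_cancel_left]
    exact fun h => aElt_not_mem_Hpm l hl1 h.1.1

end Witness

/-! ## 5. Independence statements over `CoverDataAx` -/

/-- **`hΘ` is necessary for `N_{Π_C}(Im(s_ι)) ⊆ Π_{C̲}`**: for every odd `l ≠ 1` it is FALSE that for all
`X : CoverDataAx l` and all Def. 2.1 / Prop. 2.2 (i) data `(Π_{C̲}, ι̲, E)` the normaliser of `E` lies in `Π_{C̲}`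
(p454441's `normalizer_eigen_le` minus its hypothesis `hΘ`). Independence witness only; in print `hΘ` holds.
[cite: MochizukiEtTh2009, Prop 2.2(ii) p.37] -/
theorem not_forall_normalizer_eigen_le (hl : Odd l) (hl1 : l ≠ 1) :
    ¬ ∀ (X : CoverDataAx.{0} l) (H' E : Subgroup X.PiC) (ι : X.PiC), X.toCoverData.IsTypeLTorsPm H' →
      X.toCoverData.IsInversion H' ι → X.toCoverData.IsMinusEigen (H' ⊓ X.PiX) H' ι E →
      Subgroup.normalizer ((E : Subgroup X.PiC) : Set X.PiC) ≤ H' :=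
  fun h => not_normalizer_E_le l hl hl1
    (h (abelianWitness l hl) (Hpm l) (E l) (iota l) (isTypeLTorsPm_Hpm l hl) (isInversion_iota l hl)
      (isMinusEigen_E l hl))

/-- **The printed uniqueness of the coset is not a consequence of the (i)-data**: for every odd `l ≠ 1` it is FALSE
that for all `X : CoverDataAx l` and data `(Π_{C̲}, ι̲, E)` every lift `g ∈ Δ_C ∖ Δ_X` of the nontrivial element of
`Gal(X/C)` normalising `E` lies in `ι̲·Δ_{X̲}` (p454441's `mem_normalizer_eigen_iff_of_lift`, forward direction,
minus `hΘ`). Independence witness only. [cite: MochizukiEtTh2009, Prop 2.2(ii) p.37] -/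
theorem not_forall_inversion_coset_unique (hl : Odd l) (hl1 : l ≠ 1) :
    ¬ ∀ (X : CoverDataAx.{0} l) (H' E : Subgroup X.PiC) (ι : X.PiC), X.toCoverData.IsTypeLTorsPm H' →
      X.toCoverData.IsInversion H' ι → X.toCoverData.IsMinusEigen (H' ⊓ X.PiX) H' ι E →
      ∀ g : X.PiC, g ∈ X.toCoverData.DeltaC → g ∉ X.PiX →
        g ∈ Subgroup.normalizer ((E : Subgroup X.PiC) : Set X.PiC) → ι⁻¹ * g ∈ (H' ⊓ X.PiX) ⊓ X.toCoverData.DeltaC := by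
  intro h
  obtain ⟨g, hgC, hgX, hgN, hg⟩ := exists_two_normalising_lifts l hl hl1
  exact hg (h (abelianWitness l hl) (Hpm l) (E l) (iota l) (isTypeLTorsPm_Hpm l hl) (isInversion_iota l hl)
    (isMinusEigen_E l hl) g hgC hgX hgN)

/-- The instance `l = 3` of `not_forall_normalizer_eigen_le`. [cite: MochizukiEtTh2009, Prop 2.2(ii) p.37] -/
theorem not_forall_normalizer_eigen_le_three :
    ¬ ∀ (X : CoverDataAx.{0} 3) (H' E : Subgroup X.PiC) (ι : X.PiC), X.toCoverData.IsTypeLTorsPm H' →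
      X.toCoverData.IsInversion H' ι → X.toCoverData.IsMinusEigen (H' ⊓ X.PiX) H' ι E →
      Subgroup.normalizer ((E : Subgroup X.PiC) : Set X.PiC) ≤ H' :=
  not_forall_normalizer_eigen_le 3 (by decide) (by decide)

/-- The instance `l = 3` of `not_forall_inversion_coset_unique`. [cite: MochizukiEtTh2009, Prop 2.2(ii) p.37] -/
theorem not_forall_inversion_coset_unique_three :
    ¬ ∀ (X : CoverDataAx.{0} 3) (H' E : Subgroup X.PiC) (ι : X.PiC), X.toCoverData.IsTypeLTorsPm H' →
      X.toCoverData.IsInversion H' ι → X.toCoverData.IsMinusEigen (H' ⊓ X.PiX) H' ι E →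
      ∀ g : X.PiC, g ∈ X.toCoverData.DeltaC → g ∉ X.PiX →
        g ∈ Subgroup.normalizer ((E : Subgroup X.PiC) : Set X.PiC) → ι⁻¹ * g ∈ (H' ⊓ X.PiX) ⊓ X.toCoverData.DeltaC :=
  not_forall_inversion_coset_unique 3 (by decide) (by decide)

end AbelianWitness

end ThetaCovers

end Literature.AnabelianGeometry.EtaleTheta
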